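import Literature.NumberTheory.Automorphic.LieAlgebraGL
import Literature.NumberTheory.Automorphic.ZariskiGLDimension
import Literature.NumberTheory.Automorphic.RootSubgroupProofs
import Literature.RingTheory.KrullDimension.TangentDimension
import HarnessLib

/-!
# `dim Lie(H) = dim H`: connected algebraic subgroups of `GL n` are smooth (Springer 4.3.7, 4.4.6)

Companion to `LieAlgebraGL.lean` (the Lie algebra `lieAlgebraGL H ⊆ 𝔤𝔩ₙ` of a subgroup
`H ≤ GL n k`, as the matrices `A` with `d p_1 (A) = 0` for all `p ∈ 𝓘(H)`) and
`ZariskiGLDimension.lean` (the dimension `hH.zdim` of a Zariski-connected algebraic subgroup, the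
Krull dimension of `k[x_{ij}, y]/𝓘(H)`), namespace `Literature.Automorphic`; the commutative algebra is
`Literature/RingTheory/KrullDimension/TangentDimension.lean` (tangent spaces of affine varieties
over a perfect field have dimension `dim` generically; tangent spaces in coordinates). Results:

* **`IsZConnected.finrank_lieAlgebraGL_eq`** — Springer, *Linear Algebraic Groups* (2nd ed.),
  Cor. 4.4.6: *`dim_k L(G) = dim G`*, for a Zariski-connected algebraic `H ≤ GL n k` over a
  perfect field (Springer: algebraically closed): `Module.finrank k (lieAlgebraGL H) = hH.zdim`
  (and `Lie(H)` is finite-dimensional). The proof is Springer's 4.3.7 (i) ("for fixed `g`, the map `x ↦ g.x` is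
  an isomorphism … hence `x` is simple if and only if `g.x` is simple. Now (i) follows from
  4.3.3 (ii)"): by `Literature.RingTheory.KrullDimension.exists_finrank_tangentSpaceAt_eq` (`TangentDimension.lean`,
  Springer 4.3.3 (ii): the Zariski tangent space of `V(𝓘(H))` has dimension `dim` at the points
  of a non-empty open subset) some `g ∈ H` is a simple point, and left translation by elements
  of `H` (a surjective endomorphism of `k[H] = k[x, y]/𝓘(H)`, `translateAlgHom`) transports
  tangent spaces injectively (`pointDerivations.precomp`), so `1` is simple too; finally
  `Lie(H) = T_1 H` in coordinates (`tangentCoordEquiv`: the tangent vectors of the hypersurface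
  `det(x) · y = 1` at `1` annihilated by `𝓘(H)` are the `(A, -tr A)`, `A ∈ Lie(H)`,
  Springer 4.4.10 (3)).
* `IsZConnected.eq_of_le_of_lieAlgebraGL_eq` — the standard consequence (Springer 4.4.6 with
  1.8.2, as used in 7.1.3 (i): "`𝔥 = 𝔤`, whence `H = G`"): connected algebraic `H ≤ H'` with
  `Lie(H) = Lie(H')` coincide; `IsZConnected.zdim_le_of_le` (any field, from 1.8.2) and
  `IsZConnected.finrank_lieAlgebraGL_le_of_le`.
* `lieAlgebraGL_identityComponent` — `Lie(H°) = Lie(H)` for an algebraic `H` (a polynomial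
  vanishing on `H ∖ H°` and not at `1` exists since the cosets of `H°` are closed, 2.2.1), and
  `IsAlgebraicSubgroup.finrank_lieAlgebraGL_eq` — 4.4.6 as printed, `dim L(H) = dim H°`.
* One-parameter root subgroups (Springer 8.1.1 (i)): for a root homomorphism `u` of `(G, T)`
  with character `α`, the image `U = u(𝔾ₐ)` has `dim U = 1` (`IsRootHom.zdim_map_range`: the
  comorphism embeds `k[U]` into `k[X]`, and `Lie(U) ∋ du(d/dx) ≠ 0`), `dim Lie(U) = 1`, and
  `Lie(U) = k · e_α ⊆ 𝔤_α` is the line spanned by the root vector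
  (`IsRootHom.exists_lieAlgebraGL_map_range_eq_span`,
  `IsRootHom.lieAlgebraGL_map_range_le_lieWeightSpace`; the reverse inclusion `𝔤_α ⊆ Lie(U_α)`
  is 8.1.2, not proved here).

## References

* T. A. Springer, *Linear Algebraic Groups*, 2nd ed., Progress in Mathematics 9, Birkhäuser
  (1998), 2.2.1, 4.1.3, 4.3.3, 4.3.7 (i), 4.4.5–4.4.6, 4.4.10 (3), 8.1.1 (i) [SpringerLAG1998].
-/

noncomputable section

open MvPolynomial TrivSqZeroExt DualNumber

namespace Literature.NumberTheory.Automorphic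

variable {k : Type*} [Field k] {n : Type*} [Fintype n] [DecidableEq n]

/-! ### The coordinate ring `k[x_{ij}, y]/𝓘(H)` and left translations -/

section CoordinateRing

variable (H : Subgroup (GL n k))

/-- The vanishing ideal `𝓘(H) ⊆ k[x_{ij}, y]` of (the coordinates of) a subgroup `H ≤ GL n k`
(Mathlib `MvPolynomial.vanishingIdeal`; Springer 1.1.2), abbreviated. [folklore] -/
abbrev idealGL : Ideal (MvPolynomial (GLCoord n) k) :=
  MvPolynomial.vanishingIdeal k (glCoordFun '' (H : Set (GL n k)))

variable {H}

/-- Membership in `𝓘(H)`: vanishing at all points of `H` (this is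
`mem_vanishingIdeal_glCoordFun_iff` of `IdentityComponent.lean`, restated for the abbreviation).
[folklore] -/
lemma mem_idealGL_iff {p : MvPolynomial (GLCoord n) k} :
    p ∈ idealGL H ↔ ∀ g ∈ H, eval (glCoordFun g) p = 0 :=
  mem_vanishingIdeal_glCoordFun_iff

/-- The coordinates of `g ∈ H` are a zero of `𝓘(H)`. [folklore] -/
lemma isZero_glCoordFun {g : GL n k} (hg : g ∈ H) :
    ∀ p ∈ idealGL H, eval (glCoordFun g) p = 0 := fun _ hp =>
  mem_idealGL_iff.1 hp g hg

/-- The equation `y · det(x) - 1` of `GL n` inside `𝔸^(n × n) × 𝔸¹` (Springer 2.1.4). [folklore] -/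
def detEquationGL (n k : Type*) [Fintype n] [DecidableEq n] [Field k] :
    MvPolynomial (GLCoord n) k :=
  X (Sum.inr ()) * (genericMatrixGL n k).det - 1

/-- `y · det(x) - 1` vanishes on `GL n k`, hence lies in every `𝓘(H)` (cf.
`det_mul_detInv_sub_one_mem_vanishingIdeal` of `RegularFunctionsGL.lean`, the same fact up to the
order of the factors; that file is not imported here). [folklore] -/
lemma detEquationGL_mem : detEquationGL n k ∈ idealGL H := by
  refine mem_idealGL_iff.2 fun g _ => ?_
  rw [detEquationGL, map_sub, map_mul, map_one, eval_X, RingHom.map_det,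
    eval_mapMatrix_genericMatrixGL, glCoordFun_inr, inv_mul_cancel₀, sub_self]
  exact (Matrix.isUnits_det_units g).ne_zero

/-- `(p ∘ L_h)(g) = p (h g)`: evaluating the substituted polynomial `p (leftMulPolyGL h)`.
[folklore] -/
lemma eval_aeval_leftMulPolyGL (h g : GL n k) (p : MvPolynomial (GLCoord n) k) :
    eval (glCoordFun g) (aeval (leftMulPolyGL h) p) = eval (glCoordFun (h * g)) p := by
  rw [MvPolynomial.aeval_eq_bind₁, eval_bind₁]
  have hf : (fun i => eval (glCoordFun g) (leftMulPolyGL h i)) = glCoordFun (h * g) :=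
    funext fun c => eval_leftMulPolyGL h g c
  rw [hf]

/-- For `h ∈ H`, the substitution `p ↦ p ∘ L_h` maps `𝓘(H)` into itself. [folklore] -/
lemma idealGL_le_comap {h : GL n k} (hh : h ∈ H) :
    idealGL H ≤ (idealGL H).comap (aeval (leftMulPolyGL h) :
      MvPolynomial (GLCoord n) k →ₐ[k] MvPolynomial (GLCoord n) k) := by
  intro p hp
  rw [Ideal.mem_comap]
  refine mem_idealGL_iff.2 fun g hg => ?_
  change eval (glCoordFun g) (aeval (leftMulPolyGL h) p) = 0
  rw [eval_aeval_leftMulPolyGL]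
  exact mem_idealGL_iff.1 hp _ (H.mul_mem hh hg)

variable (H)

/-- **Left translation on the coordinate ring `k[H] = k[x, y]/𝓘(H)`** (Springer 4.4.1 with
2.3: the representations `λ, ρ` of `G` by translations in `k[G]`): for `h ∈ H`, the substitution
`p ↦ p ∘ L_h` (`p (h g)` as a polynomial in the coordinates of `g`) induces a `k`-algebra
endomorphism of `k[x, y]/𝓘(H)`. [folklore] -/
def translateAlgHom {h : GL n k} (hh : h ∈ H) :
    (MvPolynomial (GLCoord n) k ⧸ idealGL H) →ₐ[k] (MvPolynomial (GLCoord n) k ⧸ idealGL H) :=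
  Ideal.quotientMapₐ (idealGL H) (aeval (leftMulPolyGL h)) (idealGL_le_comap hh)

/-- `translateAlgHom` on representatives. [folklore] -/
@[simp] lemma translateAlgHom_mk {h : GL n k} (hh : h ∈ H) (p : MvPolynomial (GLCoord n) k) :
    translateAlgHom H hh (Ideal.Quotient.mk _ p) = Ideal.Quotient.mk _ (aeval (leftMulPolyGL h) p) := by
  rw [translateAlgHom, Ideal.quotient_map_mkₐ, Ideal.Quotient.mkₐ_eq_mk]

/-- Left translation by `h ∈ H` on `k[H]` is surjective (its inverse is translation by `h⁻¹`,
modulo `𝓘(H)`). [folklore] -/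
theorem translateAlgHom_surjective {h : GL n k} (hh : h ∈ H) :
    Function.Surjective (translateAlgHom H hh) := by
  intro x
  obtain ⟨p, rfl⟩ := Ideal.Quotient.mk_surjective x
  refine ⟨Ideal.Quotient.mk _ (aeval (leftMulPolyGL h⁻¹) p), ?_⟩
  rw [translateAlgHom_mk, Ideal.Quotient.eq]
  refine mem_idealGL_iff.2 fun g _ => ?_
  rw [map_sub, eval_aeval_leftMulPolyGL, eval_aeval_leftMulPolyGL, inv_mul_cancel_left, sub_self]

/-- The `k`-point of `k[H]` defined by `g ∈ H` (evaluation at `g`). [folklore] -/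
abbrev pointGL {g : GL n k} (hg : g ∈ H) : (MvPolynomial (GLCoord n) k ⧸ idealGL H) →ₐ[k] k :=
  Literature.RingTheory.KrullDimension.pointOfZero (idealGL H) (glCoordFun g) (isZero_glCoordFun hg)

/-- Evaluation at `g` after translating by `h` is evaluation at `h g`:
`ev_g ∘ λ_h = ev_{h g}`. [folklore] -/
lemma pointGL_comp_translateAlgHom {h g : GL n k} (hh : h ∈ H) (hg : g ∈ H) :
    (pointGL H hg).comp (translateAlgHom H hh) = pointGL H (H.mul_mem hh hg) := by
  refine AlgHom.ext fun x => ?_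
  obtain ⟨p, rfl⟩ := Ideal.Quotient.mk_surjective x
  rw [AlgHom.comp_apply, translateAlgHom_mk, Literature.RingTheory.KrullDimension.pointOfZero_mk, Literature.RingTheory.KrullDimension.pointOfZero_mk,
    eval_aeval_leftMulPolyGL]

/-- **Translations transport tangent spaces** (Springer 4.3.7 (i), proof: "`x ↦ g.x` is an
isomorphism … hence `x` is simple if and only if `g.x` is simple"): for `h, g ∈ H` the
differential of `λ_h` is an injective linear map `T_g H → T_{h g} H` of point-derivation
spaces of `k[H]`. [cite: SpringerLAG1998, 4.3.7 (i) (proof)] -/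
def tangentTranslate {h g : GL n k} (hh : h ∈ H) (hg : g ∈ H) :
    Literature.RingTheory.KrullDimension.pointDerivations (pointGL H hg) →ₗ[k] Literature.RingTheory.KrullDimension.pointDerivations (pointGL H (H.mul_mem hh hg)) :=
  (LinearEquiv.ofEq _ _ (congrArg Literature.RingTheory.KrullDimension.pointDerivations (pointGL_comp_translateAlgHom H hh hg))).toLinearMap
    ∘ₗ Literature.RingTheory.KrullDimension.pointDerivations.precomp (translateAlgHom H hh) (pointGL H hg)

/-- `tangentTranslate` is injective (translation is surjective on `k[H]`). [folklore] -/
theorem tangentTranslate_injective {h g : GL n k} (hh : h ∈ H) (hg : g ∈ H) :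
    Function.Injective (tangentTranslate H hh hg) := by
  intro D₁ D₂ hD
  simp only [tangentTranslate, LinearMap.coe_comp, Function.comp_apply, LinearEquiv.coe_coe] at hD
  exact Literature.RingTheory.KrullDimension.pointDerivations.precomp_injective (translateAlgHom_surjective H hh) _
    ((LinearEquiv.injective _) hD)

/-- The injection `T_g H ↪ T_{g'} H` for `g' = h g` (`tangentTranslate` with the target
rewritten). [folklore] -/
lemma exists_injective_of_mul_eq {h g g' : GL n k} (hh : h ∈ H) (hg : g ∈ H) (hg' : g' ∈ H)
    (e : h * g = g') :
    ∃ i : Literature.RingTheory.KrullDimension.pointDerivations (pointGL H hg) →ₗ[k] Literature.RingTheory.KrullDimension.pointDerivations (pointGL H hg'),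
      Function.Injective i := by
  subst e
  exact ⟨tangentTranslate H hh hg, tangentTranslate_injective H hh hg⟩

end CoordinateRing

/-! ### `Lie(H)` is the tangent space at `1` in coordinates -/

section TangentAtOne

/-- The dual-number point `1 + ε A` of `LieAlgebraGL.lean` is the point `a + ε v` of
`TangentDimension.lean` for `a = 1`, `v = (A, -tr A)`. [folklore] -/
lemma dualPoint_eq_dualNumberPoint (A : Matrix n n k) :
    dualPoint A = Literature.RingTheory.KrullDimension.dualNumberPoint (glCoordFun (1 : GL n k)) (tangentCoord A) := rfl

/-- **The differential at `1` in coordinates**: `d p_1 (A) = ∑_c (∂p/∂c)(1) · (A, -tr A)_c`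
(Springer 4.1.2). [cite: SpringerLAG1998, 4.1.2] -/
lemma tangentDeriv_eq_linearFormOfVector (p : MvPolynomial (GLCoord n) k) (A : Matrix n n k) :
    tangentDeriv p A = Literature.RingTheory.KrullDimension.linearFormOfVector (glCoordFun (1 : GL n k)) (tangentCoord A) p := by
  rw [tangentDeriv, dualPoint_eq_dualNumberPoint, Literature.RingTheory.KrullDimension.snd_aeval_dualNumberPoint]

variable {H : Subgroup (GL n k)}

/-- `A ∈ Lie(H)` iff its tangent vector `(A, -tr A)` lies in the coordinate tangent space of
`V(𝓘(H))` at `1` (Springer 4.1.3 with 4.4.10 (3)). [folklore] -/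
lemma mem_lieAlgebraGL_iff_tangentCoord_mem {A : Matrix n n k} :
    A ∈ lieAlgebraGL H ↔
      tangentCoord A ∈ Literature.RingTheory.KrullDimension.tangentSpaceAt (idealGL H) (glCoordFun (1 : GL n k)) := by
  simp only [mem_lieAlgebraGL_iff, Literature.RingTheory.KrullDimension.mem_tangentSpaceAt_iff, tangentDeriv_eq_linearFormOfVector,
    Literature.RingTheory.KrullDimension.linearFormOfVector_apply]

/-- The matrix part of a coordinate vector. [folklore] -/
def matrixOfCoord (v : GLCoord n → k) : Matrix n n k := Matrix.of fun i j => v (Sum.inl (i, j))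

omit [DecidableEq n] in
/-- The matrix part of `(A, -tr A)` is `A`. [folklore] -/
@[simp] lemma matrixOfCoord_tangentCoord (A : Matrix n n k) : matrixOfCoord (tangentCoord A) = A := by
  ext i j; rfl

/-- The generic matrix at the point `1 + ε v`: `1 + ε M_v`. [folklore] -/
lemma mapMatrix_genericMatrixGL_dualNumberPoint (v : GLCoord n → k) :
    ((aeval (Literature.RingTheory.KrullDimension.dualNumberPoint (glCoordFun (1 : GL n k)) v) :
        MvPolynomial (GLCoord n) k →ₐ[k] k[ε]) : MvPolynomial (GLCoord n) k →+* k[ε]).mapMatrix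
      (genericMatrixGL n k) = 1 + (ε : k[ε]) • (matrixOfCoord v).map (algebraMap k k[ε]) := by
  ext1 i j
  rw [RingHom.mapMatrix_apply, Matrix.map_apply, genericMatrixGL, Matrix.of_apply, RingHom.coe_coe,
    aeval_X, Literature.RingTheory.KrullDimension.dualNumberPoint, Matrix.add_apply, Matrix.smul_apply, Matrix.map_apply, smul_eq_mul,
    TrivSqZeroExt.algebraMap_eq_inl, eps_mul_inl, glCoordFun_inl, Units.val_one, matrixOfCoord,
    Matrix.of_apply]
  congr 1
  rw [Matrix.one_apply, Matrix.one_apply]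
  split_ifs <;> simp

/-- **The tangent space of `GL n` at `1`** (Springer 4.4.10 (3), `𝔤𝔩ₙ`; the differential of
`det⁻¹` at `1` is `-tr`): a coordinate vector `v` annihilating the equation `y · det(x) - 1`
satisfies `v_y = - tr (v_x)`. [cite: SpringerLAG1998, 4.4.10 (3)] -/
lemma coord_inr_eq_neg_trace {v : GLCoord n → k}
    (hv : v ∈ Literature.RingTheory.KrullDimension.tangentSpaceAt (idealGL H) (glCoordFun (1 : GL n k))) :
    v (Sum.inr ()) = - Matrix.trace (matrixOfCoord v) := by
  have h0 := hv _ detEquationGL_mem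
  rw [← Literature.RingTheory.KrullDimension.linearFormOfVector_apply, ← Literature.RingTheory.KrullDimension.snd_aeval_dualNumberPoint] at h0
  -- compute `(y · det x - 1)(1 + ε v)` in `k[ε]`
  set q := Literature.RingTheory.KrullDimension.dualNumberPoint (glCoordFun (1 : GL n k)) v with hq
  have h1 : aeval q (detEquationGL n k) =
      q (Sum.inr ()) * (1 + (ε : k[ε]) • (matrixOfCoord v).map (algebraMap k k[ε])).det - 1 := by
    rw [detEquationGL, map_sub, map_mul, map_one, aeval_X, ← mapMatrix_genericMatrixGL_dualNumberPoint,
      ← RingHom.map_det, RingHom.coe_coe]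
  rw [h1, Matrix.det_one_add_smul, DualNumber.eps_pow_two, mul_zero, add_zero] at h0
  have htr : fst (Matrix.trace ((matrixOfCoord v).map (algebraMap k k[ε]))) =
      Matrix.trace (matrixOfCoord v) := by
    rw [← AddMonoidHom.map_trace, TrivSqZeroExt.algebraMap_eq_inl, fst_inl]
  simp only [DualNumber.snd_mul, snd_sub, snd_add, fst_add, snd_one, fst_one, DualNumber.snd_eps,
    DualNumber.fst_eps, mul_one, mul_zero, add_zero, zero_add, hq, Literature.RingTheory.KrullDimension.snd_dualNumberPoint,
    Literature.RingTheory.KrullDimension.fst_dualNumberPoint, glCoordFun_inr, Units.val_one, Matrix.det_one, inv_one, one_mul,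
    TrivSqZeroExt.fst_mul, htr, sub_zero] at h0
  linear_combination h0

variable (H)

/-- **`Lie(H) ≅ T_1 H` in coordinates** (Springer 4.1.3 with 4.4.10 (3): "if `H` is a closed
subgroup of `GL_n` we can view `𝔥` as a subalgebra of `𝔤𝔩ₙ`"): `A ↦ (A, -tr A)` is a linear
isomorphism of `lieAlgebraGL H` onto the coordinate tangent space of `V(𝓘(H))` at `1`.
[cite: SpringerLAG1998, 4.1.3 and 4.4.10 (3)] -/
def tangentCoordEquiv :
    lieAlgebraGL H ≃ₗ[k] Literature.RingTheory.KrullDimension.tangentSpaceAt (idealGL H) (glCoordFun (1 : GL n k)) where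
  toFun A := ⟨tangentCoord A.1, mem_lieAlgebraGL_iff_tangentCoord_mem.1 A.2⟩
  invFun v := ⟨matrixOfCoord v.1, by
    rw [mem_lieAlgebraGL_iff_tangentCoord_mem]
    convert v.2 using 1
    funext c
    rcases c with ⟨i, j⟩ | ⟨⟩
    · rfl
    · change - Matrix.trace (matrixOfCoord v.1) = v.1 (Sum.inr ())
      rw [coord_inr_eq_neg_trace v.2]⟩
  map_add' A B := Subtype.ext (tangentCoord_add A.1 B.1)
  map_smul' c A := Subtype.ext (tangentCoord_smul c A.1)
  left_inv A := Subtype.ext (matrixOfCoord_tangentCoord A.1)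
  right_inv v := by
    refine Subtype.ext (funext fun c => ?_)
    rcases c with ⟨i, j⟩ | ⟨⟩
    · rfl
    · change - Matrix.trace (matrixOfCoord v.1) = v.1 (Sum.inr ())
      rw [coord_inr_eq_neg_trace v.2]

end TangentAtOne

/-! ### The theorem: `dim Lie(H) = dim H` -/

section Dimension

variable {H H' : Subgroup (GL n k)}

/-- **Springer 4.4.6 (with 4.3.7 (i)): `dim_k L(H) = dim H`** for a Zariski-connected algebraic
subgroup `H ≤ GL n k` (Springer: over an algebraically closed field; the proof works over any
perfect field, for the `k`-points notions of this library): the Lie algebra `lieAlgebraGL H` is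
finite-dimensional of dimension `hH.zdim` (the Krull dimension of `k[x, y]/𝓘(H)`). Proof: some
point `g ∈ H` is simple (4.3.3 (ii), `exists_finrank_tangentSpaceAt_eq`), translations by `g`
and `g⁻¹` inject `T_1 ↪ T_g ↪ T_1` (`tangentTranslate`), and `Lie(H) ≅ T_1`
(`tangentCoordEquiv`). [cite: SpringerLAG1998, Cor 4.4.6] -/
theorem IsZConnected.finrank_lieAlgebraGL_eq [PerfectField k] (hH : IsZConnected H) :
    Module.Finite k (lieAlgebraGL H) ∧ Module.finrank k (lieAlgebraGL H) = hH.zdim := by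
  haveI : (idealGL H).IsPrime := hH.isPrime_vanishingIdeal
  obtain ⟨f, hfI, hf⟩ := Literature.RingTheory.KrullDimension.exists_finrank_tangentSpaceAt_eq (idealGL H)
  -- a simple point `g ∈ H`: `f (g) ≠ 0`
  obtain ⟨g, hg, hgf⟩ : ∃ g ∈ H, eval (glCoordFun g) f ≠ 0 := by
    by_contra hcon
    push Not at hcon
    exact hfI (mem_idealGL_iff.2 hcon)
  obtain ⟨hfin, hdim⟩ := hf (glCoordFun g) (isZero_glCoordFun hg) hgf
  haveI := hfin
  -- tangent spaces of `k[H]` at `g` and at `1`, in coordinates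
  let eg : Literature.RingTheory.KrullDimension.pointDerivations (pointGL H hg) ≃ₗ[k] Literature.RingTheory.KrullDimension.tangentSpaceAt (idealGL H) (glCoordFun g) :=
    Literature.RingTheory.KrullDimension.tangentSpaceAtEquiv (idealGL H) (glCoordFun g) (isZero_glCoordFun hg)
  let e1 : Literature.RingTheory.KrullDimension.pointDerivations (pointGL H H.one_mem) ≃ₗ[k]
      Literature.RingTheory.KrullDimension.tangentSpaceAt (idealGL H) (glCoordFun (1 : GL n k)) :=
    Literature.RingTheory.KrullDimension.tangentSpaceAtEquiv (idealGL H) (glCoordFun 1) (isZero_glCoordFun H.one_mem)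
  haveI hTg : Module.Finite k (Literature.RingTheory.KrullDimension.pointDerivations (pointGL H hg)) := Module.Finite.equiv eg.symm
  haveI : IsNoetherian k (Literature.RingTheory.KrullDimension.pointDerivations (pointGL H hg)) :=
    isNoetherian_of_isNoetherianRing_of_finite k (Literature.RingTheory.KrullDimension.pointDerivations (pointGL H hg))
  -- `T_1 ↪ T_g` by translation by `g`, `T_g ↪ T_1` by translation by `g⁻¹`
  obtain ⟨i₁, hi₁⟩ := exists_injective_of_mul_eq H hg H.one_mem hg (mul_one g)
  obtain ⟨i₂, hi₂⟩ := exists_injective_of_mul_eq H (H.inv_mem hg) hg H.one_mem (inv_mul_cancel g)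
  haveI hT1 : Module.Finite k (Literature.RingTheory.KrullDimension.pointDerivations (pointGL H H.one_mem)) :=
    Module.Finite.of_injective i₁ hi₁
  have h12 : Module.finrank k (Literature.RingTheory.KrullDimension.pointDerivations (pointGL H H.one_mem)) =
      Module.finrank k (Literature.RingTheory.KrullDimension.pointDerivations (pointGL H hg)) :=
    le_antisymm (LinearMap.finrank_le_finrank_of_injective hi₁)
      (LinearMap.finrank_le_finrank_of_injective hi₂)
  -- assemble
  let e : lieAlgebraGL H ≃ₗ[k] Literature.RingTheory.KrullDimension.pointDerivations (pointGL H H.one_mem) :=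
    (tangentCoordEquiv H).trans e1.symm
  refine ⟨Module.Finite.equiv e.symm, ?_⟩
  have hd : (Module.finrank k (Literature.RingTheory.KrullDimension.pointDerivations (pointGL H hg)) : WithBot ℕ∞) =
      ((hH.zdim : ℕ∞) : WithBot ℕ∞) := by
    rw [eg.finrank_eq, hdim, hH.coe_zdim_eq_ringKrullDim_quotient]
  rw [e.finrank_eq, h12]
  exact_mod_cast hd

/-- **Connected algebraic subgroups with the same Lie algebra coincide** (Springer 4.4.6 with
1.8.2; the argument "`𝔥 = 𝔤`, whence `H = G`" of 7.1.3 (i)): if `H ≤ H'` are Zariski-connected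
algebraic subgroups of `GL n k` (`k` perfect, e.g. algebraically closed) with
`lieAlgebraGL H = lieAlgebraGL H'`, then `H = H'`. [cite: SpringerLAG1998, 4.4.6 with 1.8.2] -/
theorem IsZConnected.eq_of_le_of_lieAlgebraGL_eq [PerfectField k] (hH : IsZConnected H)
    (hH' : IsZConnected H') (hle : H ≤ H') (heq : lieAlgebraGL H = lieAlgebraGL H') : H = H' := by
  refine hH.eq_of_le_of_zdim_eq hH' hle ?_
  rw [← hH.finrank_lieAlgebraGL_eq.2, ← hH'.finrank_lieAlgebraGL_eq.2, heq]

/-- `dim H ≤ dim H'` for connected algebraic `H ≤ H'` (Springer 1.8.2, from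
`IsZConnected.zdim_lt_of_lt`; over any field). [folklore] -/
theorem IsZConnected.zdim_le_of_le (hH : IsZConnected H) (hH' : IsZConnected H') (hle : H ≤ H') :
    hH.zdim ≤ hH'.zdim := by
  rcases hle.lt_or_eq with hlt | rfl
  · exact (hH.zdim_lt_of_lt hH' hlt).le
  · exact le_rfl

/-- `dim Lie(H) ≤ dim Lie(H')` for `H ≤ H'` with `H'` connected algebraic over a perfect field
(`Lie(H')` is finite-dimensional by 4.4.6). [folklore] -/
theorem IsZConnected.finrank_lieAlgebraGL_le_of_le [PerfectField k] (hH' : IsZConnected H')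
    (hle : H ≤ H') :
    Module.finrank k (lieAlgebraGL H) ≤ Module.finrank k (lieAlgebraGL H') := by
  haveI := hH'.finrank_lieAlgebraGL_eq.1
  exact Submodule.finrank_mono (lieAlgebraGL_mono hle)

end Dimension

/-! ### The Lie algebra only depends on the identity component -/

section IdentityComponent

variable {H : Subgroup (GL n k)}

/-- A polynomial separating `1` from the non-identity cosets of `H°` in `H`: for an algebraic
`H` there is `q` vanishing on `H ∖ H°` with `q(1) ≠ 0` (the cosets of the closed finite-index
subgroup `H°` are closed, Springer 2.2.1). [folklore] -/
lemma exists_eval_eq_zero_of_notMem_identityComponent (hH : IsAlgebraicSubgroup H) :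
    ∃ q : MvPolynomial (GLCoord n) k, eval (glCoordFun (1 : GL n k)) q ≠ 0 ∧
      ∀ x ∈ H, x ∉ identityComponent H → eval (glCoordFun x) q = 0 := by
  classical
  set K := identityComponent H with hK
  obtain ⟨S, hS⟩ := isAlgebraicSubgroup_identityComponent hH
  -- a polynomial vanishing on the coset `h K` and not at `1`, for `h ∈ H ∖ K`
  have hsep : ∀ h : GL n k, h ∉ K → ∃ q : MvPolynomial (GLCoord n) k,
      eval (glCoordFun (1 : GL n k)) q ≠ 0 ∧ ∀ x : GL n k, h⁻¹ * x ∈ K → eval (glCoordFun x) q = 0 := by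
    intro h hh
    have hh' : h⁻¹ ∉ (K : Set (GL n k)) := fun h' => hh (by simpa using K.inv_mem h')
    rw [hS] at hh'
    simp only [zeroLocusGL, Set.mem_setOf_eq, not_forall] at hh'
    obtain ⟨p, hpS, hp⟩ := hh'
    refine ⟨aeval (leftMulPolyGL h⁻¹) p, ?_, fun x hx => ?_⟩
    · rwa [eval_aeval_leftMulPolyGL, mul_one]
    · rw [eval_aeval_leftMulPolyGL]
      have hx' : h⁻¹ * x ∈ (K : Set (GL n k)) := hx
      rw [hS] at hx'
      exact hx' p hpS
  choose! qOf hqOf1 hqOf0 using hsep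
  -- multiply over a set of representatives of `H / K`
  haveI := finiteIndex_identityComponent hH
  let Q := ↥H ⧸ (K.subgroupOf H)
  haveI : Fintype Q := Fintype.ofFinite Q
  let rep : Q → GL n k := fun c => ((Quotient.out c : ↥H) : GL n k)
  let q : MvPolynomial (GLCoord n) k :=
    ∏ c : Q, if rep c ∈ K then 1 else qOf (rep c)
  refine ⟨q, ?_, fun x hx hxK => ?_⟩
  · rw [map_prod]
    refine Finset.prod_ne_zero_iff.2 fun c _ => ?_
    split_ifs with hc
    · rw [map_one]; exact one_ne_zero
    · exact hqOf1 _ hc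
  · rw [map_prod]
    let c : Q := QuotientGroup.mk ⟨x, hx⟩
    refine Finset.prod_eq_zero (Finset.mem_univ c) ?_
    have hcK : (rep c)⁻¹ * x ∈ K := by
      have h1 : (QuotientGroup.mk (Quotient.out c) : Q) = QuotientGroup.mk ⟨x, hx⟩ := Quotient.out_eq c
      rw [QuotientGroup.eq] at h1
      exact h1
    have hrep : rep c ∉ K := fun h' => hxK (by
      have := K.mul_mem h' hcK
      rwa [mul_inv_cancel_left] at this)
    rw [if_neg hrep]
    exact hqOf0 _ hrep x hcK

/-- **`Lie(H°) = Lie(H)`**: the Lie algebra of an algebraic subgroup is that of its identity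
component (Springer 4.4.6: "`dim L(G) = dim G` … applied to the identity component `G⁰`";
the tangent space at `1` only sees a neighbourhood of `1`, and `H°` is open in `H`). Proof: if
`p ∈ 𝓘(H°)` and `q` vanishes on `H ∖ H°` with `q(1) ≠ 0`, then `pq ∈ 𝓘(H)` and
`d(pq)_1 = q(1) dp_1`. [cite: SpringerLAG1998, 4.4.6] -/
theorem lieAlgebraGL_identityComponent (hH : IsAlgebraicSubgroup H) :
    lieAlgebraGL (identityComponent H) = lieAlgebraGL H := by
  refine le_antisymm (lieAlgebraGL_mono (identityComponent_le H)) fun A hA => ?_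
  rw [mem_lieAlgebraGL_iff] at hA ⊢
  intro p hp
  obtain ⟨q, hq1, hq0⟩ := exists_eval_eq_zero_of_notMem_identityComponent hH
  have hpq : p * q ∈ idealGL H := mem_idealGL_iff.2 fun x hx => by
    rw [map_mul]
    by_cases hxK : x ∈ identityComponent H
    · rw [mem_idealGL_iff.1 hp x hxK, zero_mul]
    · rw [hq0 x hx hxK, mul_zero]
  have h := hA _ hpq
  have hp1 : eval (glCoordFun (1 : GL n k)) p = 0 :=
    mem_idealGL_iff.1 hp 1 (identityComponent H).one_mem
  rw [tangentDeriv_eq_linearFormOfVector,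
    Literature.RingTheory.KrullDimension.linearFormOfVector_mem (glCoordFun (1 : GL n k)) (tangentCoord A) p q,
    Literature.RingTheory.KrullDimension.aeval_apply_eq_eval, Literature.RingTheory.KrullDimension.aeval_apply_eq_eval, hp1, zero_mul, zero_add] at h
  rw [tangentDeriv_eq_linearFormOfVector]
  exact (mul_eq_zero.1 h).resolve_left hq1

/-- **Springer 4.4.6 as printed: `dim_k L(G) = dim G°`** for an algebraic subgroup `H ≤ GL n k`
over a perfect (Springer: algebraically closed) field, `G° = identityComponent H` its identity
component (2.2.1). [cite: SpringerLAG1998, Cor 4.4.6] -/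
theorem IsAlgebraicSubgroup.finrank_lieAlgebraGL_eq [PerfectField k] (hH : IsAlgebraicSubgroup H) :
    Module.Finite k (lieAlgebraGL H) ∧
      Module.finrank k (lieAlgebraGL H) = (isZConnected_identityComponent hH).zdim := by
  rw [← lieAlgebraGL_identityComponent hH]
  exact (isZConnected_identityComponent hH).finrank_lieAlgebraGL_eq

end IdentityComponent

/-! ### One-parameter root subgroups: `dim U_α = 1` and `Lie(U_α) = k · e_α ⊆ 𝔤_α` -/

section RootSubgroup

open Polynomial

variable {G T : Subgroup (GL n k)}

/-- **The coordinate ring of `u(𝔾ₐ)` embeds in `k[X]`** (the comorphism of `u : 𝔸¹ → GL n`):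
if `u : 𝔾ₐ → G` has polynomial coordinates `P_c ∈ k[X]`, then over an infinite field a
polynomial `p` in the coordinates vanishes on `u(𝔾ₐ)` iff `p (P) = 0` in `k[X]`. [folklore] -/
lemma mem_idealGL_map_range_iff [Infinite k] {u : Multiplicative k →* ↥G} {P : GLCoord n → k[X]}
    (hP : ∀ (x : k) (c : GLCoord n), glCoordFun ((u (Multiplicative.ofAdd x) : ↥G) : GL n k) c =
      (P c).eval x)
    {p : MvPolynomial (GLCoord n) k} :
    p ∈ idealGL (u.range.map G.subtype) ↔ MvPolynomial.eval₂ Polynomial.C P p = 0 := by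
  have hpt : ∀ x : k, (MvPolynomial.eval₂ Polynomial.C P p).eval x =
      MvPolynomial.eval (glCoordFun ((u (Multiplicative.ofAdd x) : ↥G) : GL n k)) p := by
    intro x
    rw [eval_mvPolynomialEval₂_C]
    have hf : (fun c => (P c).eval x) = glCoordFun ((u (Multiplicative.ofAdd x) : ↥G) : GL n k) :=
      funext fun c => (hP x c).symm
    rw [hf]
  rw [mem_idealGL_iff]
  constructor
  · intro h
    refine Polynomial.funext fun x => ?_
    rw [hpt, Polynomial.eval_zero]
    exact h _ ⟨u (Multiplicative.ofAdd x), ⟨_, rfl⟩, rfl⟩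
  · rintro h _ ⟨_, ⟨z, rfl⟩, rfl⟩
    have hz := hpt (Multiplicative.toAdd z)
    rw [ofAdd_toAdd, h, Polynomial.eval_zero] at hz
    exact hz.symm

/-- **`dim u(𝔾ₐ) ≤ 1`**: the coordinate ring `k[u(𝔾ₐ)] = k[x, y]/𝓘(u(𝔾ₐ))` embeds into `k[X]`
(`p ↦ p ∘ u`), so its transcendence degree, i.e. its Krull dimension (`AffineDimension.lean`),
is at most `1` (Springer 2.2.5 (iv)/1.8: images of `𝔸¹`). [folklore] -/
theorem ringKrullDim_quotient_idealGL_map_range_le [Infinite k] {u : Multiplicative k →* ↥G}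
    (hu : IsAlgebraicAddHom u) [(idealGL (u.range.map G.subtype)).IsPrime] :
    ringKrullDim (MvPolynomial (GLCoord n) k ⧸ idealGL (u.range.map G.subtype)) ≤ 1 := by
  obtain ⟨P, hP⟩ := hu
  set I := idealGL (u.range.map G.subtype) with hI
  haveI : IsDomain (MvPolynomial (GLCoord n) k ⧸ I) := Ideal.Quotient.isDomain I
  -- the comorphism `k[x, y]/𝓘 → k[X]`
  let φ : MvPolynomial (GLCoord n) k →ₐ[k] k[X] := MvPolynomial.aeval P
  have hφ : ∀ p, φ p = MvPolynomial.eval₂ Polynomial.C P p := fun p => by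
    rw [MvPolynomial.aeval_def, Polynomial.algebraMap_eq]
  let ψ : (MvPolynomial (GLCoord n) k ⧸ I) →ₐ[k] k[X] :=
    Ideal.Quotient.liftₐ I φ (fun p hp => by rw [hφ]; exact (mem_idealGL_map_range_iff hP).1 hp)
  have hψ : Function.Injective ψ := by
    rw [injective_iff_map_eq_zero]
    intro x hx
    obtain ⟨p, rfl⟩ := Ideal.Quotient.mk_surjective x
    change Ideal.Quotient.lift I (φ : MvPolynomial (GLCoord n) k →+* k[X]) _
      (Ideal.Quotient.mk I p) = 0 at hx
    rw [Ideal.Quotient.lift_mk, RingHom.coe_coe, hφ] at hx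
    exact Ideal.Quotient.eq_zero_iff_mem.2 ((mem_idealGL_map_range_iff hP).2 hx)
  -- transcendence degrees
  have h1 : Algebra.trdeg k (MvPolynomial (GLCoord n) k ⧸ I) ≤ 1 := by
    have h := lift_trdeg_le_of_injective ψ hψ
    rw [Polynomial.trdeg_of_isDomain, Cardinal.lift_one] at h
    exact Cardinal.lift_le_one_iff.1 h
  rw [Literature.RingTheory.KrullDimension.ringKrullDim_eq_trdeg k (MvPolynomial (GLCoord n) k ⧸ I)]
  have h2 : Cardinal.toNat (Algebra.trdeg k (MvPolynomial (GLCoord n) k ⧸ I)) ≤ 1 := by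
    have := Cardinal.toNat_le_toNat h1 (by simp)
    simpa using this
  exact_mod_cast h2

variable [IsAlgClosed k]

/-- **`dim U_α = 1`** (Springer 8.1.1 (i): `u_α` is an isomorphism of `𝔾ₐ` onto `U_α`; here:
the image of a root homomorphism is a connected algebraic subgroup of dimension one): `≤ 1` by
`ringKrullDim_quotient_idealGL_map_range_le`, `≥ 1` because `Lie(u(𝔾ₐ))` contains the non-zero
root vector `du(d/dx)` and `dim Lie = dim` (4.4.6). [cite: SpringerLAG1998, 8.1.1 (i)] -/
theorem IsRootHom.zdim_map_range (hG : IsAlgebraicSubgroup G) {hTG : T ≤ G} {α : ↥T →* kˣ}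
    {u : Multiplicative k →* ↥G} (hu : IsRootHom G T hTG α u) :
    (hu.isZConnected_map_range hG).zdim = 1 := by
  have hU := hu.isZConnected_map_range hG
  haveI : (idealGL (u.range.map G.subtype)).IsPrime := hU.isPrime_vanishingIdeal
  refine le_antisymm ?_ ?_
  · have h := ringKrullDim_quotient_idealGL_map_range_le hu.1
    rw [← hU.coe_zdim_eq_ringKrullDim_quotient] at h
    exact_mod_cast h
  · -- `Lie(u(𝔾ₐ))` contains the non-zero root vector, and `dim Lie = dim` (4.4.6)
    obtain ⟨A, hA, hA0, -⟩ := hu.exists_weightVector_mem_lieAlgebraGL_map_range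
    obtain ⟨hfin, hdim⟩ := hU.finrank_lieAlgebraGL_eq
    haveI := hfin
    rw [← hdim]
    refine Module.finrank_pos_iff_exists_ne_zero.2 ⟨⟨A, hA⟩, fun h => hA0 ?_⟩
    exact congrArg Subtype.val h

/-- **`dim Lie(U_α) = 1`**: the Lie algebra of the image of a root homomorphism is a line
(Springer 8.1.1 (i) with 4.4.6). [cite: SpringerLAG1998, 8.1.1 (i)] -/
theorem IsRootHom.finrank_lieAlgebraGL_map_range (hG : IsAlgebraicSubgroup G) {hTG : T ≤ G}
    {α : ↥T →* kˣ} {u : Multiplicative k →* ↥G} (hu : IsRootHom G T hTG α u) :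
    Module.Finite k (lieAlgebraGL (u.range.map G.subtype)) ∧
      Module.finrank k (lieAlgebraGL (u.range.map G.subtype)) = 1 := by
  obtain ⟨hfin, h⟩ := (hu.isZConnected_map_range hG).finrank_lieAlgebraGL_eq
  exact ⟨hfin, h.trans (hu.zdim_map_range hG)⟩

/-- **`Lie(U_α) = k · e_α` with `e_α` a root vector** (Springer 8.1.1 (i): "`Im du_α = 𝔤_α`";
here: the Lie algebra of `u(𝔾ₐ)` is the line spanned by the non-zero weight vector
`e_α = du_α(d/dx)` of weight `α`, hence lies in the weight space `𝔤_α`; that `𝔤_α` is not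
bigger is 8.1.2, not proved here). [cite: SpringerLAG1998, 8.1.1 (i)] -/
theorem IsRootHom.exists_lieAlgebraGL_map_range_eq_span (hG : IsAlgebraicSubgroup G) {hTG : T ≤ G}
    {α : ↥T →* kˣ} {u : Multiplicative k →* ↥G} (hu : IsRootHom G T hTG α u) :
    ∃ A : Matrix n n k, A ≠ 0 ∧ A ∈ weightSpaceGL T α ∧
      lieAlgebraGL (u.range.map G.subtype) = k ∙ A := by
  obtain ⟨A, hA, hA0, hAw⟩ := hu.exists_weightVector_mem_lieAlgebraGL_map_range
  obtain ⟨hfin, h1⟩ := hu.finrank_lieAlgebraGL_map_range hG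
  haveI := hfin
  refine ⟨A, hA0, hAw, (Submodule.eq_of_le_of_finrank_le ((Submodule.span_singleton_le_iff_mem
    A _).2 hA) ?_).symm⟩
  rw [h1, finrank_span_singleton hA0]

/-- `Lie(U_α) ⊆ 𝔤_α`: the Lie algebra of the image of a root homomorphism for `α` lies in the
weight space of `α` in `Lie(G)` (Springer 8.1.1 (i), the inclusion `Im du_α ⊆ 𝔤_α`).
[cite: SpringerLAG1998, 8.1.1 (i)] -/
theorem IsRootHom.lieAlgebraGL_map_range_le_lieWeightSpace (hG : IsAlgebraicSubgroup G)
    {hTG : T ≤ G} {α : ↥T →* kˣ} {u : Multiplicative k →* ↥G} (hu : IsRootHom G T hTG α u) :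
    lieAlgebraGL (u.range.map G.subtype) ≤ lieWeightSpace G T α := by
  obtain ⟨A, hA0, hAw, hspan⟩ := hu.exists_lieAlgebraGL_map_range_eq_span hG
  have hle : u.range.map G.subtype ≤ G := by
    rintro _ ⟨y, -, rfl⟩; exact y.2
  have hAG : A ∈ lieAlgebraGL G := lieAlgebraGL_mono hle (by rw [hspan]; exact Submodule.mem_span_singleton_self A)
  rw [hspan]
  exact (Submodule.span_singleton_le_iff_mem A _).2 ⟨hAG, hAw⟩

end RootSubgroup

end Literature.NumberTheory.Automorphic
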